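import Summits.Ventures.HSemireg.WedgeHankelRecurrenceDual
import Summits.Ventures.HSemireg.WedgeHankelRecurrencePolar

/-!
# Venture HSemireg — THE AFFINE–POLAR DECOMPOSITION: **a class `q` of middle rank `r` whose minimal recurrence `m` (monic) has degree `d = r − e` is, uniquely, a PRIMITIVE dual class
# `dualSeq m a` (`a` a unit modulo `m`, middle rank `d`) plus a POLAR PART `τ` at infinity of exact order `e` (supported on `q_{N+1−e}, …, q_N`, `τ_{N+1−e} ≠ 0`)** — and conversely every
# such sum has middle rank `d + e` and minimal recurrence `m` (`2r ≤ N + 1`): the degree drop of the minimal recurrence IS the order at infinity, for every class over every field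

HONEST FRAMING. Part of the Lean index of the computation cell `pub-hsemireg` (seat p10 gen 27, Sunday typer «UNIFORM-IN-n»).
LINEAR ALGEBRA OF HANKEL (catalecticant) MATRICES and of polynomials over a field ONLY: no variety, no cohomology theory, no sheaf, no Ext group and no semiregularity map is constructed
here; nothing here says that HC / HC_CM / HC_AV holds; no Literature fact is declared or used.  Custodian versions as in `WedgeHankelSiegelIdeal` (1/3); the dictionary (`dualSeq m a` = the
functional `x ↦ [X^{d−1}](a x mod m)` on `K[X]/(m)` = a class supported on the subscheme `{m = 0}` of the affine rational normal curve; a tail on `(N − e, N]` = a polar part of order `e`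
at `∞`; «apolar scheme = affine part ⊔ e·∞») is QUOTED, never asserted.

WHAT IS KEYED / IN THE TREE.  N32 (`WedgeHankelRecurrenceDual`, claim #2 of p10 g27): `dualSeq`, `exists_dualSeq_of_mem_recSpace`, `dualSeq_unique`, `mem_recSpace_dualSeq`,
`rank_hankel1_half_dualSeq_of_isCoprime`, `rank_hankel1_half_dualSeq_eq_iff_isCoprime`, `dualSeq_add`, `dualSeq_smul`; N33 (`WedgeHankelRecurrencePolar`, claim #3): `mem_recSpace_add_add_iff`,
`mem_recSpace_add_tail_iff`, `mem_recSpace_add_tail`, `rank_hankel1_half_add_tail`, `recSpace_add_tail_self_eq_span`; N18 (№ 173): `recSpace_eq_bot_of_lt`, `finrank_recSpace_eq_sub_min`,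
`finiteDimensional_recSpace`, `mem_degreeLT_succ_iff`; N23 (№ 176) `recSpace_congr`; `HankelRankOne.hankel1_eq_of_agree` (tree).
THIS FILE (namespace `Summit.Ventures.HSemireg.Wedge.HankelOuter` continued; CHAINED on N32 + N33; 0 definitions):
* §515 `exists_dualSeq_eq_below_of_mem_recSpace` (`m` monic of degree `d`, `m ∈ Rec_{d+e}(q)`, `e ≤ N ⇒ q = dualSeq m a` on `[0, N − e]` for some `deg a < d`: THE AFFINE PART),
  `rank_hankel1_half_congr` (`R` reads `q` on `[0, N]`).
* §516 for `R(q) = r = d + e` and an AFFINE PART `u` (`q = u` on `[0, N − e]`): **`recSpace_affine_eq_bot`** (`k < d ⇒ Rec_k(u) = 0`), **`rank_hankel1_half_affine`** (`0 ≠ m ∈ Rec_d(u)`,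
  `2r ≤ N + 1 ⇒ R(u) = d`), **`tail_apply_ne_zero`** (`1 ≤ e ⇒ (q − u)_{N+1−e} ≠ 0`: the polar part has EXACT order `e`); for the dual affine part `u = dualSeq m a` (`m` monic, `deg m = d`):
  **`isCoprime_affine`** (`a` is a unit modulo `m`), **`dualSeq_affine_unique`**.
* §517 THE STRUCTURE THEOREMS: **`rank_half_eq_and_mem_recSpace_iff_exists_affine_polar`** (`m` monic of degree `d`, `1 ≤ e`, `2(d + e) ≤ N + 1`: `R(q) = d + e ∧ m ∈ Rec_{d+e}(q)` iff
  `q = dualSeq m a + τ` on `[0, N]` with `IsCoprime m a`, `deg a < d`, `τ = 0` on `[0, N − e]`, `τ_{N+1−e} ≠ 0`), **`rank_half_eq_and_mem_recSpace_iff_exists_affine`** (`e = 0`: `R(q) = d ∧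
  m ∈ Rec_d(q)` iff `q = dualSeq m a` on `[0, N]` with `IsCoprime m a`).
READING: N18/N26 observed that the minimal recurrence may drop below its window and produced examples; N33 proved that a polar part of exact order `e` causes exactly such a drop; this
file closes the circle: EVERY class of middle rank `r ≤ (N+1)/2` is «primitive affine class on `{m = 0}`» + «polar part of order `r − deg m` at `∞`», uniquely, and the pair (unit `a`
mod `m`, tail) parametrises the classes with minimal recurrence `m`.  With N30 (№ 243, split `m`) the affine part is a divisor class on the roots of `m` — the full `P¹` synthesis.
Nothing Ext-side.  New names only.
-/

open Module Polynomial
open scoped Matrix Polynomial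

namespace Summit.Ventures.HSemireg.Wedge.HankelOuter

open Summit.Ventures.HSemireg.Wedge Summit.Ventures.HSemireg.Wedge.Hankel Summit.Ventures.HSemireg.Wedge.HankelRankOne

variable (K : Type*) [Field K] {N : ℕ}

/-! ## §515. The affine part: a monic recurrence of degree `d` in the window `d + e + 1` determines a dual class on `[0, N − e]` -/

/-- **THE AFFINE PART: if the monic `m` of degree `d` lies in `Rec_{d+e}(q)` (`e ≤ N`), then `q` agrees on `[0, N − e]` with a dual class `dualSeq m a`, `deg a < d`** (N33's window shift
+ N32's duality on `[0, N − e]`). -/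
theorem exists_dualSeq_eq_below_of_mem_recSpace {m : K[X]} (hm : m.Monic) {e : ℕ} (he : e ≤ N) {q : ℕ → K} (hq : m ∈ recSpace K N q (m.natDegree + e)) :
    ∃ a ∈ Polynomial.degreeLT K m.natDegree, ∀ j, j + e ≤ N → q j = dualSeq K m a j := by
  obtain ⟨N', rfl⟩ := Nat.exists_eq_add_of_le' he
  rw [mem_recSpace_add_add_iff K ((mem_degreeLT_succ_iff K).mpr le_rfl)] at hq
  obtain ⟨a, ha, h⟩ := exists_dualSeq_of_mem_recSpace K hm hq
  exact ⟨a, ha, fun j hj => h j (by omega)⟩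

/-- the middle rank reads `q` on `[0, N]` only. -/
theorem rank_hankel1_half_congr {q q' : ℕ → K} (h : ∀ j ≤ N, q j = q' j) : (hankel1 K N (N / 2) q).rank = (hankel1 K N (N / 2) q').rank := by
  rw [hankel1_eq_of_agree (Nat.div_le_self N 2) h]

/-! ## §516. The affine part has middle rank `d` and the polar part has exact order `e = r − d` -/

section AffinePart

variable {r d e : ℕ} {q u : ℕ → K} {m : K[X]}
  (hq : (hankel1 K N (N / 2) q).rank = r) (hde : d + e = r) (haff : ∀ j, j + e ≤ N → q j = u j)
include hq hde haff

/-- **an affine part `u` (`q = u` on `[0, N − e]`, `R(q) = d + e`) has NO recurrence below degree `d`: `Rec_k(u) = 0` for `k < d`** — such a recurrence would survive the tail `q − u`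
(N33) and become a recurrence of `q` of window `k + e + 1 < r + 1`. -/
theorem recSpace_affine_eq_bot {k : ℕ} (hk : k < d) : recSpace K N u k = ⊥ := by
  rw [Submodule.eq_bot_iff]
  intro p hp
  have hτ : ∀ j, j + e ≤ N → (q - u) j = 0 := fun j hj => by rw [Pi.sub_apply, haff j hj, sub_self]
  have e1 : u + (q - u) = q := by funext j; simp only [Pi.add_apply, Pi.sub_apply]; ring
  have h1 : p ∈ recSpace K N q (k + e) := by
    rw [← e1]
    exact (mem_recSpace_add_tail_iff K hτ (by have := natDegree_le_of_mem_recSpace K hp; omega)).mpr (recSpace_mono K _ (Nat.le_add_right k e) hp)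
  have h0 := recSpace_eq_bot_of_lt K hq (show k + e < r by omega)
  rw [h0, Submodule.mem_bot] at h1
  exact h1

/-- **… so an affine part carrying a non-zero recurrence `m ∈ Rec_d(u)` has middle rank exactly `d`: `R(u) = d`** (`2r ≤ N + 1`). -/
theorem rank_hankel1_half_affine (hmu : m ∈ recSpace K N u d) (hm0 : m ≠ 0) (h2 : r + r ≤ N + 1) : (hankel1 K N (N / 2) u).rank = d := by
  refine le_antisymm ?_ ?_
  · by_contra hlt
    have h0 := recSpace_eq_bot_of_lt K (N := N) (q := u) rfl (show d < (hankel1 K N (N / 2) u).rank by omega)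
    rw [h0, Submodule.mem_bot] at hmu
    exact hm0 hmu
  · by_contra hlt
    set k := (hankel1 K N (N / 2) u).rank with hk
    have hbot := recSpace_affine_eq_bot K hq hde haff (show k < d by omega)
    haveI := finiteDimensional_recSpace K (N := N) u k
    have hdim := finrank_recSpace_eq_sub_min K (show k ≤ N by omega) u
    rw [hbot, finrank_bot, ← hk] at hdim
    have : min (min (k + 1) (N + 1 - k)) k = k := min_eq_right (by rw [le_min_iff]; omega)
    omega

/-- **the polar part `q − u` has EXACT order `e`: for `1 ≤ e` and a non-zero recurrence `m ∈ Rec_d(u)`, `(q − u)_{N+1−e} ≠ 0`** — otherwise the tail has order `≤ e − 1` and `m` survives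
as a recurrence of `q` of window `r` (N33), contradicting `R(q) = r`. -/
theorem tail_apply_ne_zero (hmu : m ∈ recSpace K N u d) (hm0 : m ≠ 0) (he : 1 ≤ e) : (q - u) (N + 1 - e) ≠ 0 := by
  intro h0
  have hτ : ∀ j, j + (e - 1) ≤ N → (q - u) j = 0 := by
    intro j hj
    rcases Nat.lt_or_ge (j + e) (N + 1) with hlt | hge
    · rw [Pi.sub_apply, haff j (by omega), sub_self]
    · rw [show j = N + 1 - e by omega]; exact h0
  have e1 : u + (q - u) = q := by funext j; simp only [Pi.add_apply, Pi.sub_apply]; ring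
  have h1 : m ∈ recSpace K N q (d + (e - 1)) := by
    rw [← e1]; exact mem_recSpace_add_tail K hτ hmu
  have h0' := recSpace_eq_bot_of_lt K hq (show d + (e - 1) < r by omega)
  rw [h0', Submodule.mem_bot] at h1
  exact hm0 h1

end AffinePart

section Decomposition

variable {r e : ℕ} {q : ℕ → K} {m a : K[X]}
  (hq : (hankel1 K N (N / 2) q).rank = r) (hmo : m.Monic) (hde : m.natDegree + e = r) (h2 : r + r ≤ N + 1)
  (haff : ∀ j, j + e ≤ N → q j = dualSeq K m a j)
include hq hmo hde h2 haff

/-- **the dual affine part is PRIMITIVE: `a` is a unit modulo `m`** (N32: middle rank `d` ⇔ `IsCoprime m a`). -/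
theorem isCoprime_affine : IsCoprime m a := by
  classical
  exact (rank_hankel1_half_dualSeq_eq_iff_isCoprime K hmo (by omega)).mp
    (rank_hankel1_half_affine K hq hde haff (mem_recSpace_dualSeq K hmo a) hmo.ne_zero h2)

omit hq in
/-- **the dual affine part is unique** (`deg a, deg a′ < d`). -/
theorem dualSeq_affine_unique (ha : a ∈ Polynomial.degreeLT K m.natDegree) {a' : K[X]} (ha' : a' ∈ Polynomial.degreeLT K m.natDegree)
    (haff' : ∀ j, j + e ≤ N → q j = dualSeq K m a' j) : a = a' :=
  dualSeq_unique K (N := N - e) hmo (by omega) ha ha' fun j hj => by rw [← haff j (by omega), haff' j (by omega)]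

end Decomposition

/-! ## §517. The structure theorems: middle rank `d + e` with minimal recurrence `m` of degree `d` ⟺ primitive affine part modulo `m` + polar part of exact order `e` -/

/-- **THE AFFINE–POLAR STRUCTURE THEOREM.  For a monic `m` of degree `d`, `1 ≤ e` and `2(d + e) ≤ N + 1`:
`R(q) = d + e` and `m ∈ Rec_{d+e}(q)`  iff  `q = dualSeq m a + τ` on `[0, N]` with `a` a unit modulo `m` of degree `< d`, `τ = 0` on `[0, N − e]` and `τ_{N+1−e} ≠ 0`.** -/
theorem rank_half_eq_and_mem_recSpace_iff_exists_affine_polar {m : K[X]} (hmo : m.Monic) {e : ℕ} (he : 1 ≤ e) (h2 : (m.natDegree + e) + (m.natDegree + e) ≤ N + 1) (q : ℕ → K) :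
    ((hankel1 K N (N / 2) q).rank = m.natDegree + e ∧ m ∈ recSpace K N q (m.natDegree + e))
      ↔ ∃ (a : K[X]) (τ : ℕ → K), IsCoprime m a ∧ a ∈ Polynomial.degreeLT K m.natDegree ∧ (∀ j, j + e ≤ N → τ j = 0) ∧ τ (N + 1 - e) ≠ 0
          ∧ ∀ j ≤ N, q j = dualSeq K m a j + τ j := by
  constructor
  · rintro ⟨hq, hm⟩
    obtain ⟨a, ha, haff⟩ := exists_dualSeq_eq_below_of_mem_recSpace K hmo (by omega) hm
    exact ⟨a, q - dualSeq K m a, isCoprime_affine K hq hmo rfl h2 haff, ha, fun j hj => by rw [Pi.sub_apply, haff j hj, sub_self],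
      tail_apply_ne_zero K hq rfl haff (mem_recSpace_dualSeq K hmo a) hmo.ne_zero he, fun j _ => by rw [Pi.sub_apply]; ring⟩
  · rintro ⟨a, τ, hcop, -, hτ, hτe, h⟩
    have hu : (hankel1 K N (N / 2) (dualSeq K m a)).rank = m.natDegree := rank_hankel1_half_dualSeq_of_isCoprime K hmo hcop (by omega)
    have hmem : m ∈ recSpace K N (dualSeq K m a) m.natDegree := mem_recSpace_dualSeq K hmo a
    have hagree : ∀ j ≤ N, q j = (dualSeq K m a + τ) j := fun j hj => by rw [Pi.add_apply, h j hj]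
    refine ⟨?_, ?_⟩
    · rw [rank_hankel1_half_congr K hagree]
      exact rank_hankel1_half_add_tail K hu hmem hmo.ne_zero rfl hτ hτe he h2
    · rw [recSpace_congr K hagree, recSpace_add_tail_self_eq_span K hu hmem hmo.ne_zero rfl hτ hτe he h2]
      exact Submodule.mem_span_singleton_self m

/-- the case `e = 0` (no node at infinity; N32 read with the middle rank): **`R(q) = d` and `m ∈ Rec_d(q)` iff `q = dualSeq m a` on `[0, N]` with `a` a unit modulo `m`** (`2d ≤ N + 1`). -/
theorem rank_half_eq_and_mem_recSpace_iff_exists_affine {m : K[X]} (hmo : m.Monic) (h2 : m.natDegree + m.natDegree ≤ N + 1) (q : ℕ → K) :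
    ((hankel1 K N (N / 2) q).rank = m.natDegree ∧ m ∈ recSpace K N q m.natDegree)
      ↔ ∃ a : K[X], IsCoprime m a ∧ a ∈ Polynomial.degreeLT K m.natDegree ∧ ∀ j ≤ N, q j = dualSeq K m a j := by
  constructor
  · rintro ⟨hq, hm⟩
    obtain ⟨a, ha, haff⟩ := exists_dualSeq_of_mem_recSpace K hmo hm
    have haff' : ∀ j, j + 0 ≤ N → q j = dualSeq K m a j := fun j hj => haff j (by omega)
    exact ⟨a, isCoprime_affine K (e := 0) hq hmo (add_zero _) h2 haff', ha, haff⟩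
  · rintro ⟨a, hcop, -, h⟩
    refine ⟨?_, ?_⟩
    · rw [rank_hankel1_half_congr K h]
      exact rank_hankel1_half_dualSeq_of_isCoprime K hmo hcop h2
    · rw [recSpace_congr K h]
      exact mem_recSpace_dualSeq K hmo a

end Summit.Ventures.HSemireg.Wedge.HankelOuter
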